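/-
Copyright: harness cell b2b-lgcu-borel (gen 13).  Honest framing: the VALUE here is a THEOREM
(an all-`p` packing law for one configuration class, proved in `DecoratedSylowLaw`) — NOT summit
progress; the crux item `SubgroupIdentityDesigns` (stmt-MatrixMultiplication-14079) stays open.
-/
import Summits.MatrixMultiplication.MatrixMultiplication.Theorems.SubgroupIdentityDesigns.Negative.BorelVolumeBound
import Summits.MatrixMultiplication.MatrixMultiplication.Theorems.SubgroupIdentityDesigns.Negative.FamilyADesign

/-!
# Decorated Sylow subgroups of `GL₂(𝔽_p)`: the three shapes and their diagonal images

Entry-level bookkeeping for subgroups `U_x ≤ H ≤ B_x` of `GL₂(𝔽_p)` (`B_x` the stabiliser of a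
point `x ∈ ℙ¹(𝔽_p)`, `U_x` its unipotent radical) at the three points `[e₀]` (upper triangular,
`h₁₀ = 0`), `[e₁]` (lower triangular, `h₀₁ = 0`) and `[e₀ + e₁]` (`h₀₀ + h₀₁ = h₁₀ + h₁₁`,
column-vector action).  "`H ⊇ U_x`" is stated as: every element of the shape with both
eigenvalues `1` lies in `H`.

* `mem_of_upper_diag`, `mem_of_lower_diag`, `mem_of_mid_diag`: such an `H` is the full preimage
  of its "diagonal" image in `T = 𝔽_pˣ × 𝔽_pˣ` (for the middle shape the diagonal is
  (eigenvalue on `(1,1)`, eigenvalue on the quotient) `= (h₀₀ + h₀₁, h₁₁ - h₀₁)`);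
* `exists_diagUpper`, `exists_diagLower`, `exists_diagMid`: the diagonal maps as homomorphisms;
* `card_le_of_diag_upper/lower/mid`: `|H| ≤ p · |diag(H)|`.

Used by `DecoratedSylowLaw` (`|H₁||H₂||H₃| ≤ p³(p-1)` for subgroup-TPP triples of decorated
Sylows).  Sorry-free; no new definitions.
-/

set_option linter.dupNamespace false

noncomputable section

open scoped BigOperators Classical
open Summit.MatrixMultiplication.MatrixMultiplication.Theorems.LieRankDesigns.Negative (GLm Mat)

namespace Summit.MatrixMultiplication.MatrixMultiplication.Theorems.SubgroupIdentityDesigns.Negative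

section DecoratedSylow

open Literature.Barriers.MatrixMultiplication (SubgroupTPP)

variable {p : ℕ}

/-! ### Explicit `2 × 2` bookkeeping (no primality needed) -/

/-- Entries of a product in `GL₂`. -/
theorem gl2_mul_apply (a b : GLm p 2) (i j : Fin 2) :
    ((a * b : GLm p 2) : Mat p 2) i j
      = (a : Mat p 2) i 0 * (b : Mat p 2) 0 j + (a : Mat p 2) i 1 * (b : Mat p 2) 1 j := by
  rw [Units.val_mul, Matrix.mul_apply, Fin.sum_univ_two]

/-- Elements of `GL₂` are determined by their four entries. -/
theorem gl2_ext {g h : GLm p 2} (h00 : (g : Mat p 2) 0 0 = (h : Mat p 2) 0 0)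
    (h01 : (g : Mat p 2) 0 1 = (h : Mat p 2) 0 1) (h10 : (g : Mat p 2) 1 0 = (h : Mat p 2) 1 0)
    (h11 : (g : Mat p 2) 1 1 = (h : Mat p 2) 1 1) : g = h := by
  apply Units.ext
  ext i j
  fin_cases i <;> fin_cases j
  · exact h00
  · exact h01
  · exact h10
  · exact h11

/-- Entries of `1`. -/
theorem gl2_one_apply :
    ((1 : GLm p 2) : Mat p 2) 0 0 = 1 ∧ ((1 : GLm p 2) : Mat p 2) 0 1 = 0 ∧
      ((1 : GLm p 2) : Mat p 2) 1 0 = 0 ∧ ((1 : GLm p 2) : Mat p 2) 1 1 = 1 := by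
  refine ⟨?_, ?_, ?_, ?_⟩ <;> simp

/-- In the stabiliser of the line through `(1,1)` the determinant factors as
(eigenvalue on `(1,1)`) · (eigenvalue on the quotient). -/
theorem mid_det_eq (g : GLm p 2)
    (hg : (g : Mat p 2) 0 0 + (g : Mat p 2) 0 1 = (g : Mat p 2) 1 0 + (g : Mat p 2) 1 1) :
    (g : Mat p 2) 0 0 * (g : Mat p 2) 1 1 - (g : Mat p 2) 0 1 * (g : Mat p 2) 1 0
      = ((g : Mat p 2) 0 0 + (g : Mat p 2) 0 1) * ((g : Mat p 2) 1 1 - (g : Mat p 2) 0 1) := by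
  linear_combination ((g : Mat p 2) 0 1) * hg

variable [Fact p.Prime]

/-- An element of `GL₂(𝔽_p)` with prescribed entries `[[a, b], [c, d]]`, `ad - bc ≠ 0`. -/
theorem exists_gl2 (a b c d : ZMod p) (h : a * d - b * c ≠ 0) :
    ∃ g : GLm p 2, (g : Mat p 2) 0 0 = a ∧ (g : Mat p 2) 0 1 = b ∧
      (g : Mat p 2) 1 0 = c ∧ (g : Mat p 2) 1 1 = d := by
  refine ⟨Matrix.GeneralLinearGroup.mkOfDetNeZero !![a, b; c, d]
    (by rwa [Matrix.det_fin_two_of]), ?_, ?_, ?_, ?_⟩ <;> rfl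

/-! ### The three shapes are full preimages of their diagonal images

Shape hypotheses, on entries (`g v` = column-vector action): `H ≤ B⁺` is `h₁₀ = 0`;
`H ≤ B⁻` is `h₀₁ = 0`; `H ≤ B_{[1:1]}` (stabiliser of the line through `(1,1)`) is
`h₀₀ + h₀₁ = h₁₀ + h₁₁`.  `H ⊇ U` is: every element of that shape with both "eigenvalues"
equal to `1` lies in `H`. -/

/-- Upper shape: an upper-triangular `g` whose diagonal agrees with that of some `h ∈ H` lies in
`H`, provided `U⁺ ≤ H ≤ B⁺`. -/
theorem mem_of_upper_diag {H : Subgroup (GLm p 2)} (hB : ∀ h ∈ H, (h : Mat p 2) 1 0 = 0)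
    (hU : ∀ u : GLm p 2, (u : Mat p 2) 1 0 = 0 → (u : Mat p 2) 0 0 = 1 → (u : Mat p 2) 1 1 = 1 →
      u ∈ H)
    {g h : GLm p 2} (hg : (g : Mat p 2) 1 0 = 0) (hh : h ∈ H)
    (e00 : (h : Mat p 2) 0 0 = (g : Mat p 2) 0 0) (e11 : (h : Mat p 2) 1 1 = (g : Mat p 2) 1 1) :
    g ∈ H := by
  obtain ⟨n0, -⟩ := upper_diag_ne_zero h (hB h hh)
  obtain ⟨u, u00, u01, u10, u11⟩ :=
    exists_gl2 (1 : ZMod p) (((g : Mat p 2) 0 1 - (h : Mat p 2) 0 1) * ((h : Mat p 2) 0 0)⁻¹) 0 1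
      (by simp)
  have hinv : (h : Mat p 2) 0 0 * ((h : Mat p 2) 0 0)⁻¹ = 1 := mul_inv_cancel₀ n0
  have key : g = h * u := by
    apply gl2_ext <;> rw [gl2_mul_apply]
    · rw [u00, u10, ← e00]; ring
    · rw [u01, u11]
      linear_combination (-((g : Mat p 2) 0 1 - (h : Mat p 2) 0 1)) * hinv
    · rw [u00, u10, hB h hh, hg]; ring
    · rw [u01, u11, hB h hh, ← e11]; ring
  rw [key]; exact H.mul_mem hh (hU u u10 u00 u11)

/-- A lower-triangular element of `GL₂` has non-zero diagonal entries. -/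
theorem lower_diag_ne_zero (g : GLm p 2) (hg : (g : Mat p 2) 0 1 = 0) :
    (g : Mat p 2) 0 0 ≠ 0 ∧ (g : Mat p 2) 1 1 ≠ 0 := by
  have := FamilyADesign.det_ne g
  rw [hg, zero_mul, sub_zero] at this
  exact mul_ne_zero_iff.mp this

/-- Lower shape: the analogue for `U⁻ ≤ H ≤ B⁻`. -/
theorem mem_of_lower_diag {H : Subgroup (GLm p 2)} (hB : ∀ h ∈ H, (h : Mat p 2) 0 1 = 0)
    (hU : ∀ u : GLm p 2, (u : Mat p 2) 0 1 = 0 → (u : Mat p 2) 0 0 = 1 → (u : Mat p 2) 1 1 = 1 →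
      u ∈ H)
    {g h : GLm p 2} (hg : (g : Mat p 2) 0 1 = 0) (hh : h ∈ H)
    (e00 : (h : Mat p 2) 0 0 = (g : Mat p 2) 0 0) (e11 : (h : Mat p 2) 1 1 = (g : Mat p 2) 1 1) :
    g ∈ H := by
  obtain ⟨n0, -⟩ := lower_diag_ne_zero h (hB h hh)
  obtain ⟨u, u00, u01, u10, u11⟩ :=
    exists_gl2 (1 : ZMod p) 0 (((g : Mat p 2) 1 0 - (h : Mat p 2) 1 0) * ((h : Mat p 2) 0 0)⁻¹) 1
      (by simp)
  have hinv : (h : Mat p 2) 0 0 * ((h : Mat p 2) 0 0)⁻¹ = 1 := mul_inv_cancel₀ n0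
  have key : g = u * h := by
    apply gl2_ext <;> rw [gl2_mul_apply]
    · rw [u00, u01, ← e00]; ring
    · rw [u00, u01, hB h hh, hg]; ring
    · rw [u10, u11]
      linear_combination (-((g : Mat p 2) 1 0 - (h : Mat p 2) 1 0)) * hinv
    · rw [u10, u11, hB h hh, ← e11]; ring
  rw [key]; exact H.mul_mem (hU u u01 u00 u11) hh

/-- Both eigenvalues of an element of the stabiliser of the line through `(1,1)` are non-zero. -/
theorem mid_ne_zero (g : GLm p 2)
    (hg : (g : Mat p 2) 0 0 + (g : Mat p 2) 0 1 = (g : Mat p 2) 1 0 + (g : Mat p 2) 1 1) :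
    (g : Mat p 2) 0 0 + (g : Mat p 2) 0 1 ≠ 0 ∧ (g : Mat p 2) 1 1 - (g : Mat p 2) 0 1 ≠ 0 := by
  have := FamilyADesign.det_ne g
  rw [mid_det_eq g hg] at this
  exact mul_ne_zero_iff.mp this

/-- Middle shape: `g` in the stabiliser of the line through `(1,1)` whose two eigenvalues agree
with those of some `h ∈ H` lies in `H`, provided `U_{[1:1]} ≤ H ≤ B_{[1:1]}`. -/
theorem mem_of_mid_diag {H : Subgroup (GLm p 2)}
    (hB : ∀ h ∈ H, (h : Mat p 2) 0 0 + (h : Mat p 2) 0 1 = (h : Mat p 2) 1 0 + (h : Mat p 2) 1 1)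
    (hU : ∀ u : GLm p 2,
      (u : Mat p 2) 0 0 + (u : Mat p 2) 0 1 = (u : Mat p 2) 1 0 + (u : Mat p 2) 1 1 →
      (u : Mat p 2) 0 0 + (u : Mat p 2) 0 1 = 1 → (u : Mat p 2) 1 1 - (u : Mat p 2) 0 1 = 1 →
      u ∈ H)
    {g h : GLm p 2}
    (hg : (g : Mat p 2) 0 0 + (g : Mat p 2) 0 1 = (g : Mat p 2) 1 0 + (g : Mat p 2) 1 1)
    (hh : h ∈ H)
    (eκ : (h : Mat p 2) 0 0 + (h : Mat p 2) 0 1 = (g : Mat p 2) 0 0 + (g : Mat p 2) 0 1)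
    (eρ : (h : Mat p 2) 1 1 - (h : Mat p 2) 0 1 = (g : Mat p 2) 1 1 - (g : Mat p 2) 0 1) :
    g ∈ H := by
  have hBh := hB h hh
  obtain ⟨nκ, -⟩ := mid_ne_zero h hBh
  -- `g = h · u(ν)` with `u(ν) = 1 + ν [[1,-1],[1,-1]]`, `κ ν = g₀₀ - h₀₀`, `κ = h₀₀ + h₀₁`
  obtain ⟨ν, hκν⟩ : ∃ ν : ZMod p,
      ((h : Mat p 2) 0 0 + (h : Mat p 2) 0 1) * ν = (g : Mat p 2) 0 0 - (h : Mat p 2) 0 0 :=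
    ⟨((h : Mat p 2) 0 0 + (h : Mat p 2) 0 1)⁻¹ * ((g : Mat p 2) 0 0 - (h : Mat p 2) 0 0),
      by rw [mul_inv_cancel_left₀ nκ]⟩
  obtain ⟨u, u00, u01, u10, u11⟩ := exists_gl2 (1 + ν) (-ν) ν (1 - ν) (by
    have e : (1 + ν) * (1 - ν) - -ν * ν = 1 := by ring
    rw [e]; exact one_ne_zero)
  have key : g = h * u := by
    apply gl2_ext <;> rw [gl2_mul_apply]
    · rw [u00, u10]
      linear_combination (-1 : ZMod p) * hκν
    · rw [u01, u11]
      linear_combination hκν - eκ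
    · rw [u00, u10]
      linear_combination ν * hBh - hκν - hg + hBh + eρ
    · rw [u01, u11]
      linear_combination (-ν) * hBh + hκν - eρ - eκ
  rw [key]
  refine H.mul_mem hh (hU u ?_ ?_ ?_)
  · rw [u00, u01, u10, u11]; ring
  · rw [u00, u01]; ring
  · rw [u11, u01]; ring

/-! ### Diagonal images: homomorphisms to `T = 𝔽_pˣ × 𝔽_pˣ` -/

/-- Diagonal of an upper-triangular subgroup. -/
theorem exists_diagUpper {H : Subgroup (GLm p 2)} (hB : ∀ h ∈ H, (h : Mat p 2) 1 0 = 0) :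
    ∃ φ : H →* (ZMod p)ˣ × (ZMod p)ˣ, ∀ h : H,
      ((φ h).1 : ZMod p) = ((h : GLm p 2) : Mat p 2) 0 0 ∧
        ((φ h).2 : ZMod p) = ((h : GLm p 2) : Mat p 2) 1 1 :=
  ⟨{ toFun := fun h => (Units.mk0 _ (upper_diag_ne_zero (h : GLm p 2) (hB h h.2)).1,
        Units.mk0 _ (upper_diag_ne_zero (h : GLm p 2) (hB h h.2)).2)
     map_one' := Prod.ext (Units.ext (by simp)) (Units.ext (by simp))
     map_mul' := fun a b => Prod.ext
        (Units.ext (by simp [upper_mul_apply00 (hB _ b.2)]))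
        (Units.ext (by simp [upper_mul_apply11 (hB _ a.2)])) },
    fun _ => ⟨rfl, rfl⟩⟩

/-- Diagonal of a lower-triangular subgroup. -/
theorem exists_diagLower {H : Subgroup (GLm p 2)} (hB : ∀ h ∈ H, (h : Mat p 2) 0 1 = 0) :
    ∃ φ : H →* (ZMod p)ˣ × (ZMod p)ˣ, ∀ h : H,
      ((φ h).1 : ZMod p) = ((h : GLm p 2) : Mat p 2) 0 0 ∧
        ((φ h).2 : ZMod p) = ((h : GLm p 2) : Mat p 2) 1 1 :=
  ⟨{ toFun := fun h => (Units.mk0 _ (lower_diag_ne_zero (h : GLm p 2) (hB h h.2)).1,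
        Units.mk0 _ (lower_diag_ne_zero (h : GLm p 2) (hB h h.2)).2)
     map_one' := Prod.ext (Units.ext (by simp)) (Units.ext (by simp))
     map_mul' := fun a b => Prod.ext
        (Units.ext (by simp [gl2_mul_apply, hB _ a.2]))
        (Units.ext (by simp [gl2_mul_apply, hB _ b.2])) },
    fun _ => ⟨rfl, rfl⟩⟩

/-- "Diagonal" of a subgroup of the stabiliser of the line through `(1,1)`:
(eigenvalue on `(1,1)`, eigenvalue on the quotient) `= (h₀₀ + h₀₁, h₁₁ - h₀₁)`. -/
theorem exists_diagMid {H : Subgroup (GLm p 2)}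
    (hB : ∀ h ∈ H, (h : Mat p 2) 0 0 + (h : Mat p 2) 0 1 = (h : Mat p 2) 1 0 + (h : Mat p 2) 1 1) :
    ∃ φ : H →* (ZMod p)ˣ × (ZMod p)ˣ, ∀ h : H,
      ((φ h).1 : ZMod p) = ((h : GLm p 2) : Mat p 2) 0 0 + ((h : GLm p 2) : Mat p 2) 0 1 ∧
        ((φ h).2 : ZMod p) = ((h : GLm p 2) : Mat p 2) 1 1 - ((h : GLm p 2) : Mat p 2) 0 1 :=
  ⟨{ toFun := fun h => (Units.mk0 _ (mid_ne_zero (h : GLm p 2) (hB h h.2)).1,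
        Units.mk0 _ (mid_ne_zero (h : GLm p 2) (hB h h.2)).2)
     map_one' := Prod.ext (Units.ext (by simp)) (Units.ext (by simp))
     map_mul' := fun a b => Prod.ext
        (Units.ext (by
          simp only [Prod.fst_mul, Units.val_mk0, Units.val_mul, Subgroup.coe_mul, gl2_mul_apply]
          linear_combination (-((a : GLm p 2) : Mat p 2) 0 1) * hB _ b.2))
        (Units.ext (by
          simp only [Prod.snd_mul, Units.val_mk0, Units.val_mul, Subgroup.coe_mul, gl2_mul_apply]
          linear_combination (-((b : GLm p 2) : Mat p 2) 0 1) * hB _ a.2)) },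
    fun _ => ⟨rfl, rfl⟩⟩

/-! ### `|H| ≤ p · |D|` for each shape -/

/-- `|H| ≤ p · |diag(H)|` for an upper-triangular subgroup. -/
theorem card_le_of_diag_upper {H : Subgroup (GLm p 2)} (hB : ∀ h ∈ H, (h : Mat p 2) 1 0 = 0)
    (φ : H →* (ZMod p)ˣ × (ZMod p)ˣ) (hφ : ∀ h : H,
      ((φ h).1 : ZMod p) = ((h : GLm p 2) : Mat p 2) 0 0 ∧
        ((φ h).2 : ZMod p) = ((h : GLm p 2) : Mat p 2) 1 1) :
    Nat.card H ≤ p * Nat.card φ.range := by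
  let Ψ : H → φ.range × ZMod p := fun h => (⟨φ h, ⟨h, rfl⟩⟩, ((h : GLm p 2) : Mat p 2) 0 1)
  have hΨ : Function.Injective Ψ := by
    intro h h' e
    simp only [Ψ, Prod.mk.injEq, Subtype.mk.injEq] at e
    obtain ⟨e1, e2⟩ := e
    refine Subtype.ext (gl2_ext ?_ e2 (by rw [hB _ h.2, hB _ h'.2]) ?_)
    · rw [← (hφ h).1, ← (hφ h').1, e1]
    · rw [← (hφ h).2, ← (hφ h').2, e1]
  calc Nat.card H ≤ Nat.card (φ.range × ZMod p) := Nat.card_le_card_of_injective Ψ hΨ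
    _ = p * Nat.card φ.range := by rw [Nat.card_prod, Nat.card_zmod, mul_comm]

/-- `|H| ≤ p · |diag(H)|` for a lower-triangular subgroup. -/
theorem card_le_of_diag_lower {H : Subgroup (GLm p 2)} (hB : ∀ h ∈ H, (h : Mat p 2) 0 1 = 0)
    (φ : H →* (ZMod p)ˣ × (ZMod p)ˣ) (hφ : ∀ h : H,
      ((φ h).1 : ZMod p) = ((h : GLm p 2) : Mat p 2) 0 0 ∧
        ((φ h).2 : ZMod p) = ((h : GLm p 2) : Mat p 2) 1 1) :
    Nat.card H ≤ p * Nat.card φ.range := by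
  let Ψ : H → φ.range × ZMod p := fun h => (⟨φ h, ⟨h, rfl⟩⟩, ((h : GLm p 2) : Mat p 2) 1 0)
  have hΨ : Function.Injective Ψ := by
    intro h h' e
    simp only [Ψ, Prod.mk.injEq, Subtype.mk.injEq] at e
    obtain ⟨e1, e2⟩ := e
    refine Subtype.ext (gl2_ext ?_ (by rw [hB _ h.2, hB _ h'.2]) e2 ?_)
    · rw [← (hφ h).1, ← (hφ h').1, e1]
    · rw [← (hφ h).2, ← (hφ h').2, e1]
  calc Nat.card H ≤ Nat.card (φ.range × ZMod p) := Nat.card_le_card_of_injective Ψ hΨ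
    _ = p * Nat.card φ.range := by rw [Nat.card_prod, Nat.card_zmod, mul_comm]

/-- `|H| ≤ p · |(κ,ρ)(H)|` for a subgroup of the stabiliser of the line through `(1,1)`. -/
theorem card_le_of_diag_mid {H : Subgroup (GLm p 2)}
    (hB : ∀ h ∈ H, (h : Mat p 2) 0 0 + (h : Mat p 2) 0 1 = (h : Mat p 2) 1 0 + (h : Mat p 2) 1 1)
    (φ : H →* (ZMod p)ˣ × (ZMod p)ˣ) (hφ : ∀ h : H,
      ((φ h).1 : ZMod p) = ((h : GLm p 2) : Mat p 2) 0 0 + ((h : GLm p 2) : Mat p 2) 0 1 ∧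
        ((φ h).2 : ZMod p) = ((h : GLm p 2) : Mat p 2) 1 1 - ((h : GLm p 2) : Mat p 2) 0 1) :
    Nat.card H ≤ p * Nat.card φ.range := by
  let Ψ : H → φ.range × ZMod p := fun h => (⟨φ h, ⟨h, rfl⟩⟩, ((h : GLm p 2) : Mat p 2) 0 1)
  have hΨ : Function.Injective Ψ := by
    intro h h' e
    simp only [Ψ, Prod.mk.injEq, Subtype.mk.injEq] at e
    obtain ⟨e1, e2⟩ := e
    have a1 : ((h : GLm p 2) : Mat p 2) 0 0 + ((h : GLm p 2) : Mat p 2) 0 1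
        = ((h' : GLm p 2) : Mat p 2) 0 0 + ((h' : GLm p 2) : Mat p 2) 0 1 := by
      rw [← (hφ h).1, ← (hφ h').1, e1]
    have a2 : ((h : GLm p 2) : Mat p 2) 1 1 - ((h : GLm p 2) : Mat p 2) 0 1
        = ((h' : GLm p 2) : Mat p 2) 1 1 - ((h' : GLm p 2) : Mat p 2) 0 1 := by
      rw [← (hφ h).2, ← (hφ h').2, e1]
    have hh := hB _ h.2
    have hh' := hB _ h'.2
    refine Subtype.ext (gl2_ext ?_ e2 ?_ ?_)
    · linear_combination a1 - e2
    · linear_combination a1 - a2 - e2 - hh + hh'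
    · linear_combination a2 + e2
  calc Nat.card H ≤ Nat.card (φ.range × ZMod p) := Nat.card_le_card_of_injective Ψ hΨ
    _ = p * Nat.card φ.range := by rw [Nat.card_prod, Nat.card_zmod, mul_comm]

end DecoratedSylow

end Summit.MatrixMultiplication.MatrixMultiplication.Theorems.SubgroupIdentityDesigns.Negative
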